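import Literature.MathematicalPhysics.QuantumFieldTheory.BalabanImbrieJaffe1984to88.BIJ85NoZeroModes309Torus
import Literature.MathematicalPhysics.QuantumFieldTheory.BalabanImbrieJaffe1984to88.BIJ85Sigma421Torus

/-!
# `BalabanImbrieJaffe1984to88.BIJ85NoZeroModes309TorusPart2` — T. Bałaban, J. Imbrie, A. Jaffe, *Renormalization of the Higgs
model: minimizers, propagators and the stability of mean field theory*, Commun. Math. Phys. **97** (1985) 299–329
[BalabanImbrieJaffe1985]: (5.3.1), (4.2.1), (4.2.7), (4.3.1)–(4.3.2) ON THE TORI of the series — the hypothesis `hD` (no zero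
modes, p. 309) DISCHARGED by `…BIJ85NoZeroModes309Torus.hD_holds`

statement-level skeleton of published theorems with citation tags; proofs where landed; nothing here is a claim about the Yang–Mills mass gap

PDF held: `paper:balaban1985-cmp97-bij-higgs-minimizers` (journal page = PDF page + 298).

CITATION HEADER (lean-in-tree rule).  Phase-2 proof seat p33 (gen 2) of `lit-balaban` (HOME `run/shared/lean/pub/lit-balaban/`),
companion of `…BIJ85NoZeroModes309Torus` (SKELETON row **C1.Claim@309** on the torus carrier, every k).  That file proved the p. 309
claim *"Such zero modes do not occur"* on the tori of `…Balaban1983to89.LatticeFieldCalculus` and restated p09's (4.1.1)/(4.1.3)–(4.1.5)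
torus theorems without their standing hypothesis
`hD : ∀ A : VecField P 0 ℝ, A ∈ constraint411 k → (∀ p, curl c A p = 0) → A = 0`.
WHAT IS DONE HERE: the same one-line discharge for the torus theorems of seat p30 (gen 3) that carry `hD` verbatim —
`…BIJ85Eq531Proof` (row **C1.Eq5.3.1**: `torusHax_eq_sub_propagator`, **(5.3.1)** `eq531_torus` / `eq531_torus_eta`,
`bondAvgIter_Hax` ((4.1.5) for the field of (5.3.1)), `deltaAx_Hax`, `Hax_minimizes`) and `…BIJ85Sigma421Torus` (rows
**C1.Eq4.2.1-4.2.2** / **C1.Eq4.2.4-4.2.7** / **C1.Eq4.3.1-4.3.3** on the torus: **(4.2.1)** `isSigmaForm_sigmaTorus`, (4.2.7)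
`sigmaTorus_form_bounds`, **(4.3.1)–(4.3.2)** `sigmaTorus_curl` / `sigmaTorus_curl_le` / `sigmaTorus_curl_eq_deltaTorus`): each
`…_holds` theorem below has the statement of the cited theorem with `hD` replaced by the standing clauses `k ≤ m + K` (already
present where the block geometry enters) and `c ≠ 0` (the lattice factor of `∂`; for the `η`-units version `c = L^k`, automatic).
Nothing else is asserted; no new `def`; axioms standard.  Unit `lit-balaban-p33` gen 2 (literature-prover-lit-balaban-p33-g2-0), 2026-08-21.
-/

open scoped BigOperators RealInnerProductSpace

namespace Literature.MathematicalPhysics.QuantumFieldTheory.BalabanImbrieJaffe1984to88.BIJ85NoZeroModes309TorusPart2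

open Literature.MathematicalPhysics.QuantumFieldTheory.Balaban1983to89
open LatticeFieldCalculus BIJ85AxialPropagator411 BIJ85AxialMinimizer413 BIJ85Eq531Inputs BIJ85Eq531Proof BIJ85SigmaForm421
  BIJ85Sigma421Torus BIJ85NoZeroModes309Torus

noncomputable section

variable {P : Params}

/-! ## §1  Sect. 5.3 on the torus without `hD` (p30's `BIJ85Eq531Proof`) -/

/-- `H_{k,Ax}(A₀) = A₀ − G_{k,Ax}∂^*∂A₀` on the torus for every representative `A₀` — p30's `torusHax_eq_sub_propagator`, `hD`
discharged (`k ≤ m + K`, `w > 0`, `c ≠ 0`). [cite: BalabanImbrieJaffe1985, (5.3.1) p.317] -/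
theorem torusHax_eq_sub_propagator_holds {k : ℕ} (hk : k ≤ P.m + P.K) {w : ℝ} (hw : 0 < w) {c : ℝ} (hc : c ≠ 0)
    (A₀ : VecField P 0 ℝ) :
    torusHax w c k A₀ = A₀ - torusPropagator w c k (plaqDiv c (curl c A₀)) :=
  torusHax_eq_sub_propagator hw c k (hD_holds hk hc) A₀

/-- **(5.3.1) on the torus, unconditionally**: `H_{k,Ax}B = Q^{s*}_kB − G_{k,Ax}∂^*Q^{e*}_k∂B` — p30's `eq531_torus`, `hD` discharged
(`2 ≤ d`, `k ≤ m + K`, `w > 0`, `c ≠ 0`). [cite: BalabanImbrieJaffe1985, (5.3.1) p.317] -/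
theorem eq531_torus_holds (hd : 2 ≤ P.d) {k : ℕ} (hk : k ≤ P.m + P.K) {w : ℝ} (hw : 0 < w) {c : ℝ} (hc : c ≠ 0)
    (B : PBond P k → ℝ) :
    torusHax w c k (QsstarIter k B) =
      QsstarIter k B - torusPropagator w c k (plaqDiv c (QestarIter hd k (curl (c / (P.L : ℝ) ^ k) B))) :=
  eq531_torus hd hk hw c (hD_holds hk hc) B

/-- **(5.3.1) in the units of Sects. 4–5** (`η⁻¹ = L^k` on `T_η`, factor `1` on the unit lattice), unconditionally — p30's
`eq531_torus_eta`, `hD` discharged. [cite: BalabanImbrieJaffe1985, (5.3.1) p.317] -/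
theorem eq531_torus_eta_holds (hd : 2 ≤ P.d) {k : ℕ} (hk : k ≤ P.m + P.K) {w : ℝ} (hw : 0 < w) (B : PBond P k → ℝ) :
    torusHax w ((P.L : ℝ) ^ k) k (QsstarIter k B) =
      QsstarIter k B - torusPropagator w ((P.L : ℝ) ^ k) k (plaqDiv ((P.L : ℝ) ^ k) (QestarIter hd k (curl 1 B))) :=
  eq531_torus_eta hd hk hw (hD_holds hk (pow_ne_zero _ (Nat.cast_ne_zero.mpr P.L_pos.ne'))) B

/-- **(4.1.5) for the field of (5.3.1)**, unconditionally: `Q_k(H_{k,Ax}B) = B` — p30's `bondAvgIter_Hax`, `hD` discharged.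
[cite: BalabanImbrieJaffe1985, (4.1.5) p.310] -/
theorem bondAvgIter_Hax_holds {k : ℕ} (hk : k ≤ P.m + P.K) {w : ℝ} (hw : 0 < w) {c : ℝ} (hc : c ≠ 0) (B : PBond P k → ℝ) :
    bondAvgIter k (torusHax w c k (QsstarIter k B)) = B :=
  bondAvgIter_Hax hk hw c (hD_holds hk hc) B

/-- `H_{k,Ax}B` of (5.3.1) satisfies `δ_{k,Ax}`, unconditionally — p30's `deltaAx_Hax`, `hD` discharged. [cite: BalabanImbrieJaffe1985, (4.1.5) p.310] -/
theorem deltaAx_Hax_holds {k : ℕ} (hk : k ≤ P.m + P.K) {w : ℝ} (hw : 0 < w) {c : ℝ} (hc : c ≠ 0) (B : PBond P k → ℝ) :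
    deltaAx k (torusHax w c k (QsstarIter k B)) :=
  deltaAx_Hax hk hw c (hD_holds hk hc) B

/-- **`H_{k,Ax}B` minimizes `½‖∂A‖²` on `{Q_kA = B, δ_{k,Ax}(A)}`**, unconditionally — p30's `Hax_minimizes`, `hD` discharged.
[cite: BalabanImbrieJaffe1985, (4.1.3) p.310] -/
theorem Hax_minimizes_holds {k : ℕ} (hk : k ≤ P.m + P.K) {w : ℝ} (hw : 0 < w) {c : ℝ} (hc : c ≠ 0) (B : PBond P k → ℝ)
    {A : VecField P 0 ℝ} (hQ : bondAvgIter k A = B) (hAx : deltaAx k A) :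
    curlAction w c (torusHax w c k (QsstarIter k B)) ≤ curlAction w c A :=
  Hax_minimizes hk hw c (hD_holds hk hc) B hQ hAx

/-! ## §2  σ_k on the torus without `hD` (p30's `BIJ85Sigma421Torus`) -/

/-- **(4.2.1) on the torus, unconditionally**: `sigmaTorus` satisfies the defining identity (4.2.1) — p30's `isSigmaForm_sigmaTorus`,
`hD` discharged (`2 ≤ d`, `k ≤ m + K`, `w > 0`, `c ≠ 0`). [cite: BalabanImbrieJaffe1985, (4.2.1) p.310] -/
theorem isSigmaForm_sigmaTorus_holds (hd : 2 ≤ P.d) {k : ℕ} (hk : k ≤ P.m + P.K) {w : ℝ} (hw : 0 < w) {c : ℝ} (hc : c ≠ 0) :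
    IsSigmaForm (V411 P k) (curlOp (P := P) w c) (QesOp (P := P) hd w k) (sigmaTorus (P := P) hd w c k) :=
  isSigmaForm_sigmaTorus hd hw c k (hD_holds hk hc)

/-- `0 ≤ ⟨f, σ_kf⟩ ≤ ‖Q^{e*}_kf‖²_η` on the torus, unconditionally — p30's `sigmaTorus_form_bounds`, `hD` discharged.
[cite: BalabanImbrieJaffe1985, (4.2.7) p.311] -/
theorem sigmaTorus_form_bounds_holds (hd : 2 ≤ P.d) {k : ℕ} (hk : k ≤ P.m + P.K) {w : ℝ} (hw : 0 < w) {c : ℝ} (hc : c ≠ 0)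
    (f : UnitPlaqSpace P k) :
    0 ≤ ⟪f, sigmaTorus (P := P) hd w c k f⟫ ∧ ⟪f, sigmaTorus (P := P) hd w c k f⟫ ≤ ‖QesOp (P := P) hd w k f‖ ^ 2 :=
  sigmaTorus_form_bounds hd hw c k (hD_holds hk hc) f

/-- **(4.3.1)–(4.3.2) on the torus, unconditionally**: `⟨∂B, σ_k∂B⟩ = Σ_pη^d|(∂H_{k,Ax}B)(p)|²` — p30's `sigmaTorus_curl`, `hD`
discharged. [cite: BalabanImbrieJaffe1985, (4.3.2) p.311] -/
theorem sigmaTorus_curl_holds (hd : 2 ≤ P.d) {k : ℕ} (hk : k ≤ P.m + P.K) {w : ℝ} (hw : 0 < w) {c : ℝ} (hc : c ≠ 0)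
    (B : PBond P k → ℝ) :
    ⟪toU P k (curl (c / (P.L : ℝ) ^ k) B), sigmaTorus (P := P) hd w c k (toU P k (curl (c / (P.L : ℝ) ^ k) B))⟫ =
      2 * curlAction w c (torusHax w c k (QsstarIter k B)) :=
  sigmaTorus_curl hd hk hw c (hD_holds hk hc) B

/-- **(4.3.2), the bound**, unconditionally: `⟨∂B, σ_k∂B⟩ ≤ Σ_pη^d|(∂A)(p)|²` for every `A` with `Q_kA = B`, `δ_{k,Ax}(A)` — p30's
`sigmaTorus_curl_le`, `hD` discharged. [cite: BalabanImbrieJaffe1985, (4.3.2) p.311] -/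
theorem sigmaTorus_curl_le_holds (hd : 2 ≤ P.d) {k : ℕ} (hk : k ≤ P.m + P.K) {w : ℝ} (hw : 0 < w) {c : ℝ} (hc : c ≠ 0)
    (B : PBond P k → ℝ) {A : VecField P 0 ℝ} (hQ : bondAvgIter k A = B) (hAx : deltaAx k A) :
    ⟪toU P k (curl (c / (P.L : ℝ) ^ k) B), sigmaTorus (P := P) hd w c k (toU P k (curl (c / (P.L : ℝ) ^ k) B))⟫ ≤
      2 * curlAction w c A :=
  sigmaTorus_curl_le hd hk hw c (hD_holds hk hc) B hQ hAx

/-- **(4.3.1) on the torus, unconditionally**: `⟨∂B, σ_k∂B⟩ = ⟨B, Δ_kB⟩` for `sigmaTorus`/`deltaTorus` — p30's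
`sigmaTorus_curl_eq_deltaTorus`, `hD` discharged. [cite: BalabanImbrieJaffe1985, (4.3.1) p.311] -/
theorem sigmaTorus_curl_eq_deltaTorus_holds (hd : 2 ≤ P.d) {k : ℕ} (hk : k ≤ P.m + P.K) {w : ℝ} (hw : 0 < w) {c : ℝ}
    (hc : c ≠ 0) (B : PBond P k → ℝ) :
    ⟪toU P k (curl (c / (P.L : ℝ) ^ k) B), sigmaTorus (P := P) hd w c k (toU P k (curl (c / (P.L : ℝ) ^ k) B))⟫ =
      deltaTorus w c k B :=
  sigmaTorus_curl_eq_deltaTorus hd hk hw c (hD_holds hk hc) B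

end

end Literature.MathematicalPhysics.QuantumFieldTheory.BalabanImbrieJaffe1984to88.BIJ85NoZeroModes309TorusPart2
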